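import Summits.QuantumFields.YangMills.Theorems.LuscherReductionOneSiteLevelsKacFlattenJump
import Summits.QuantumFields.YangMills.Theorems.LuscherReductionOneSiteLevelsGnDiag

/-!
# INNER, layer II (flat tail): `flatJump t G ≤ flatJumpBall t (2R₀) G + t⁻¹ · T · ∫ G²` with the Gaussian tail
# `T = ∫_{‖z‖ ≥ R₀} p_t(z) dz ≤ √2⁹ e^{−R₀²/(4t)}`

Support module of crux `OneSiteLevels` (route `LuscherReduction`, item stmt-QuantumFields-20007; STUB-PLAN
`Cruxes/OneSiteLevels/STUB-PLAN-stub_absUpperInnerAL1.md` §2.2 item II.4, §2.4 (4) and §2.5 (3) «tail region»), fleet seat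
ym-luscher-20007-p2 (LATTICE lane).  Everything here is proved, AL1-free; pure flat measure theory on `ZM = ℝ⁹`.

The kernel minorant of the flattening step (`…KacFlattenJump`) only sees the ball pair `‖y‖, ‖y′‖ ≤ R`; the part of the flat jump
form `flatJump t G` with one point far out is controlled here by the Gaussian tail of the heat kernel, for `G` supported in
`‖y‖ ≤ R₀` and `R = 2R₀`:
* §1 `heatKer₀`, `tailKer t R₀ z = 1_{‖z‖ ≥ R₀} p_t(z)`; `tailKer_le` (`e^{−‖z‖²/(2t)} ≤ e^{−R₀²/(4t)} e^{−‖z‖²/(4t)}` off the ball),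
  `integral_tailKer_le`: `∫ tailKer ≤ √2⁹ · e^{−R₀²/(4t)}` (`∫ e^{−‖z‖²/(4t)} = √(4πt)⁹`, `GaussForm.integral_exp_neg_mul_sq_norm`).
* §2 `jumpIntegrand_le_three_terms`: pointwise `p_t(x,y)(G x − G y)² ≤ 1_R(x)1_R(y)p_t(G x − G y)² + G(x)² tailKer(y−x) + G(y)² tailKer(x−y)`
  (if one point is outside `‖·‖ ≤ 2R₀` the other is in the support ball or the term vanishes, and then the points are `≥ R₀` apart).
* §3 **`flatJump_le_flatJumpBall_add`**: integrate (outer integral by `integral_mono_of_nonneg`, so no integrability of the iterated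
  integrand of `flatJump` is needed; the three majorants are product-integrable: `integrable_flatJumpBall_integrand` and the shear
  formula `integrable_and_integral_shear` of `…GnDiag`): `flatJump t G ≤ flatJumpBall t (2R₀) G + t⁻¹ (∫ tailKer)(∫ G²)`.

## WHAT THIS IS NOT
Not the INNER stub; femto rung R2b1 vocabulary; NOT an infinite-volume ∕ Clay gap statement.
-/

set_option autoImplicit false

noncomputable section

open MeasureTheory Filter Topology Real
open scoped ENNReal
open Literature.MathematicalPhysics.QuantumFieldTheory
open Literature.MathematicalPhysics.QuantumLattice
open Literature.Analysis.OperatorTheory.YMMatrixModel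

namespace Summit.QuantumFields.YangMills.Theorems.FemtoTransferGap

/-! ### §1. The translation-invariant heat kernel and its tail -/

/-- The heat kernel as a function of the difference: `p_t(z) = (√(2πt)⁹)⁻¹ e^{−‖z‖²/(2t)}`. [cite: ReedSimonIV1978, Thm. XIII.1–2] -/
def heatKer₀ (t : ℝ) (z : ZM) : ℝ := (Real.sqrt (2 * π * t) ^ 9)⁻¹ * Real.exp (-‖z‖ ^ 2 / (2 * t))

/-- `p_t(x,y) = p_t(x − y)` (`t > 0`). [folklore] -/
theorem heatKernel_eq_heatKer₀ {t : ℝ} (ht : 0 < t) (x y : ZM) : heatKernel t x y = heatKer₀ t (x - y) := by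
  rw [heatKernel_eq ht, heatKer₀]

/-- `p_t(x,y) = p_t(y − x)` (`t > 0`). [folklore] -/
theorem heatKernel_eq_heatKer₀' {t : ℝ} (ht : 0 < t) (x y : ZM) : heatKernel t x y = heatKer₀ t (y - x) := by
  rw [heatKernel_eq_heatKer₀ ht, heatKer₀, heatKer₀, norm_sub_rev]

/-- `0 ≤ p_t(z)`. [folklore] -/
theorem heatKer₀_nonneg (t : ℝ) (z : ZM) : 0 ≤ heatKer₀ t z := by
  unfold heatKer₀; positivity

/-- `p_t` is continuous. [folklore] -/
theorem continuous_heatKer₀ (t : ℝ) : Continuous (heatKer₀ t) := by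
  unfold heatKer₀
  exact continuous_const.mul (Real.continuous_exp.comp ((continuous_norm.pow 2).neg.div_const _))

/-- **The tail kernel** `tailKer t R₀ z = 1_{‖z‖ ≥ R₀} · p_t(z)`. [folklore] -/
def tailKer (t R₀ : ℝ) (z : ZM) : ℝ := if R₀ ≤ ‖z‖ then heatKer₀ t z else 0

/-- `0 ≤ tailKer`. [folklore] -/
theorem tailKer_nonneg (t R₀ : ℝ) (z : ZM) : 0 ≤ tailKer t R₀ z := by
  unfold tailKer; split_ifs
  · exact heatKer₀_nonneg t z
  · exact le_rfl

/-- `tailKer ≤ p_t`. [folklore] -/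
theorem tailKer_le_heatKer₀ (t R₀ : ℝ) (z : ZM) : tailKer t R₀ z ≤ heatKer₀ t z := by
  unfold tailKer; split_ifs
  · exact le_rfl
  · exact heatKer₀_nonneg t z

/-- `tailKer` is measurable. [folklore] -/
theorem measurable_tailKer (t R₀ : ℝ) : Measurable (tailKer t R₀) := by
  unfold tailKer
  exact Measurable.ite (measurableSet_le measurable_const continuous_norm.measurable) (continuous_heatKer₀ t).measurable
    measurable_const

/-- **Pointwise Gaussian tail bound**: `tailKer t R₀ z ≤ e^{−R₀²/(4t)} · (√(2πt)⁹)⁻¹ e^{−‖z‖²/(4t)}` (`t > 0`, `R₀ ≥ 0`). [folklore] -/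
theorem tailKer_le {t : ℝ} (ht : 0 < t) {R₀ : ℝ} (hR₀ : 0 ≤ R₀) (z : ZM) :
    tailKer t R₀ z ≤ Real.exp (-(R₀ ^ 2 / (4 * t))) * ((Real.sqrt (2 * π * t) ^ 9)⁻¹ * Real.exp (-(1 / (4 * t)) * ‖z‖ ^ 2)) := by
  unfold tailKer
  split_ifs with h
  · rw [heatKer₀]
    have hz : R₀ ^ 2 ≤ ‖z‖ ^ 2 := pow_le_pow_left₀ hR₀ h 2
    have e : Real.exp (-‖z‖ ^ 2 / (2 * t)) = Real.exp (-(‖z‖ ^ 2 / (4 * t))) * Real.exp (-(1 / (4 * t)) * ‖z‖ ^ 2) := by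
      rw [← Real.exp_add]; congr 1; field_simp; ring
    rw [e]
    have h1 : Real.exp (-(‖z‖ ^ 2 / (4 * t))) ≤ Real.exp (-(R₀ ^ 2 / (4 * t))) :=
      Real.exp_le_exp.2 (neg_le_neg (div_le_div_of_nonneg_right hz (by positivity)))
    calc (Real.sqrt (2 * π * t) ^ 9)⁻¹ * (Real.exp (-(‖z‖ ^ 2 / (4 * t))) * Real.exp (-(1 / (4 * t)) * ‖z‖ ^ 2))
        = Real.exp (-(‖z‖ ^ 2 / (4 * t))) * ((Real.sqrt (2 * π * t) ^ 9)⁻¹ * Real.exp (-(1 / (4 * t)) * ‖z‖ ^ 2)) := by ring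
      _ ≤ _ := mul_le_mul_of_nonneg_right h1 (by positivity)
  · positivity

/-- `tailKer` is integrable (`t > 0`, `R₀ ≥ 0`). [folklore] -/
theorem integrable_tailKer {t : ℝ} (ht : 0 < t) {R₀ : ℝ} (hR₀ : 0 ≤ R₀) : Integrable (tailKer t R₀) := by
  have hb : 0 < 1 / (4 * t) := by positivity
  have hg := (GaussForm.integrable_gauss (ι := Fin 3 × Fin 3) hb).const_mul
    (Real.exp (-(R₀ ^ 2 / (4 * t))) * (Real.sqrt (2 * π * t) ^ 9)⁻¹)
  refine hg.mono' (measurable_tailKer t R₀).aestronglyMeasurable (ae_of_all _ fun z => ?_)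
  rw [Real.norm_eq_abs, abs_of_nonneg (tailKer_nonneg t R₀ z)]
  calc tailKer t R₀ z ≤ Real.exp (-(R₀ ^ 2 / (4 * t))) * ((Real.sqrt (2 * π * t) ^ 9)⁻¹ * Real.exp (-(1 / (4 * t)) * ‖z‖ ^ 2)) :=
        tailKer_le ht hR₀ z
    _ = Real.exp (-(R₀ ^ 2 / (4 * t))) * (Real.sqrt (2 * π * t) ^ 9)⁻¹ * Real.exp (-(1 / (4 * t)) * ‖z‖ ^ 2) := by ring

/-- **The Gaussian tail integral**: `∫ tailKer t R₀ ≤ √2⁹ · e^{−R₀²/(4t)}` (`∫ e^{−‖z‖²/(4t)} dz = √(4πt)⁹ = √2⁹ √(2πt)⁹` on `ℝ⁹`).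
[folklore] -/
theorem integral_tailKer_le {t : ℝ} (ht : 0 < t) {R₀ : ℝ} (hR₀ : 0 ≤ R₀) :
    ∫ z, tailKer t R₀ z ≤ Real.sqrt 2 ^ 9 * Real.exp (-(R₀ ^ 2 / (4 * t))) := by
  have hπ := Real.pi_pos
  have hb : 0 < 1 / (4 * t) := by positivity
  have hS : 0 < Real.sqrt (2 * π * t) ^ 9 := by positivity
  have hgi := GaussForm.integrable_gauss (ι := Fin 3 × Fin 3) hb
  have hgv : ∫ z : ZM, Real.exp (-(1 / (4 * t)) * ‖z‖ ^ 2) = Real.sqrt 2 ^ 9 * Real.sqrt (2 * π * t) ^ 9 := by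
    rw [GaussForm.integral_exp_neg_mul_sq_norm hb, Fintype.card_prod, Fintype.card_fin,
      show π / (1 / (4 * t)) = 2 * (2 * π * t) by field_simp; ring, Real.sqrt_mul (by norm_num : (0:ℝ) ≤ 2), mul_pow]
  calc ∫ z, tailKer t R₀ z
      ≤ ∫ z : ZM, Real.exp (-(R₀ ^ 2 / (4 * t))) * ((Real.sqrt (2 * π * t) ^ 9)⁻¹ * Real.exp (-(1 / (4 * t)) * ‖z‖ ^ 2)) :=
        integral_mono (integrable_tailKer ht hR₀) ((hgi.const_mul _).const_mul _) fun z => tailKer_le ht hR₀ z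
    _ = Real.sqrt 2 ^ 9 * Real.exp (-(R₀ ^ 2 / (4 * t))) := by
        rw [integral_const_mul, integral_const_mul, hgv]
        field_simp

/-! ### §2. The pointwise three-term majorant -/

/-- **Three-term majorant of the jump integrand.**  If `G` vanishes outside `‖y‖ ≤ R₀` (`R₀ ≥ 0`), then for all `x, y`
`p_t(x,y)(G x − G y)² ≤ 1_{2R₀}(x)1_{2R₀}(y) p_t(x,y)(G x − G y)² + G(x)² tailKer(y − x) + G(y)² tailKer(x − y)`. [folklore] -/
theorem jumpIntegrand_le_three_terms {t : ℝ} (ht : 0 < t) {G : ZM → ℝ} {R₀ : ℝ} (hR₀ : 0 ≤ R₀)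
    (hsupp : ∀ y, G y ≠ 0 → ‖y‖ ≤ R₀) (x y : ZM) :
    heatKernel t x y * (G x - G y) ^ 2 ≤
      ballInd (2 * R₀) x * ballInd (2 * R₀) y * (heatKernel t x y * (G x - G y) ^ 2) +
        G x ^ 2 * tailKer t R₀ (y - x) + G y ^ 2 * tailKer t R₀ (x - y) := by
  have hk0 := heatKernel_nonneg ht x y
  have hP0 : 0 ≤ heatKernel t x y * (G x - G y) ^ 2 := by positivity
  have h2 : 0 ≤ G x ^ 2 * tailKer t R₀ (y - x) := mul_nonneg (sq_nonneg _) (tailKer_nonneg _ _ _)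
  have h3 : 0 ≤ G y ^ 2 * tailKer t R₀ (x - y) := mul_nonneg (sq_nonneg _) (tailKer_nonneg _ _ _)
  by_cases hx : ‖x‖ ≤ 2 * R₀
  · by_cases hy : ‖y‖ ≤ 2 * R₀
    · simp only [ballInd, if_pos hx, if_pos hy, one_mul]
      linarith
    · -- `y` far out: `G y = 0`
      have hGy : G y = 0 := by
        by_contra h; exact hy ((hsupp y h).trans (by linarith))
      have hby : ballInd (2 * R₀) y = 0 := by simp [ballInd, hy]
      rw [hGy, hby]
      by_cases hGx : G x = 0
      · rw [hGx]; simp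
      · have hxR : ‖x‖ ≤ R₀ := hsupp x hGx
        have hy' : 2 * R₀ < ‖y‖ := lt_of_not_ge hy
        have hfar : R₀ ≤ ‖y - x‖ := by
          have := norm_sub_norm_le y x
          linarith
        have htk : tailKer t R₀ (y - x) = heatKernel t x y := by
          rw [tailKer, if_pos hfar, heatKernel_eq_heatKer₀' ht]
        rw [htk]
        nlinarith [sq_nonneg (G x), h3, hk0]
  · -- `x` far out: `G x = 0`
    have hGx : G x = 0 := by
      by_contra h; exact hx ((hsupp x h).trans (by linarith))
    have hbx : ballInd (2 * R₀) x = 0 := by simp [ballInd, hx]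
    rw [hGx, hbx]
    by_cases hGy : G y = 0
    · rw [hGy]; simp
    · have hyR : ‖y‖ ≤ R₀ := hsupp y hGy
      have hx' : 2 * R₀ < ‖x‖ := lt_of_not_ge hx
      have hfar : R₀ ≤ ‖x - y‖ := by
        have := norm_sub_norm_le x y
        linarith
      have htk : tailKer t R₀ (x - y) = heatKernel t x y := by
        rw [tailKer, if_pos hfar, heatKernel_eq_heatKer₀ ht]
      rw [htk]
      nlinarith [sq_nonneg (G y), h2, hk0]

/-! ### §3. Integration: the tail estimate -/

/-- **II.4, tail — `flatJump t G ≤ flatJumpBall t (2R₀) G + t⁻¹ (∫ tailKer t R₀)(∫ G²)`** for `t > 0` and a bounded measurable `G`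
supported in `‖y‖ ≤ R₀` (`R₀ ≥ 0`).  The outer integral of `flatJump` is compared by `integral_mono_of_nonneg` (no integrability of the
iterated integrand is needed); the majorants are product-integrable and the two tail terms are evaluated by the shear formula.
[cite: LiebYau1988, (2.9)–(2.11)] -/
theorem flatJump_le_flatJumpBall_add {t : ℝ} (ht : 0 < t) {G : ZM → ℝ} (hGm : Measurable G) {M : ℝ} (hGb : ∀ y, |G y| ≤ M)
    {R₀ : ℝ} (hR₀ : 0 ≤ R₀) (hsupp : ∀ y, G y ≠ 0 → ‖y‖ ≤ R₀) :
    flatJump t G ≤ flatJumpBall t (2 * R₀) G + 1 / t * (∫ z, tailKer t R₀ z) * ∫ y, G y ^ 2 := by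
  -- the three majorants on the product space
  have hG2i : Integrable fun y => G y ^ 2 := integrable_sq_of_bounded_of_support hGm hGb hsupp
  have hKi := integrable_tailKer ht hR₀
  have hQ1 := integrable_flatJumpBall_integrand ht hGm hGb (2 * R₀)
  obtain ⟨hQ2, vQ2⟩ := integrable_and_integral_shear (h := fun y => G y ^ 2) (k := tailKer t R₀) hG2i hKi
  obtain ⟨hQ3, vQ3⟩ := integrable_and_integral_shear_swap (h := fun y => G y ^ 2) (k := tailKer t R₀) hG2i hKi
  set Q : ZM × ZM → ℝ := fun q => ballInd (2 * R₀) q.1 * ballInd (2 * R₀) q.2 * (heatKernel t q.1 q.2 * (G q.1 - G q.2) ^ 2) +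
    G q.1 ^ 2 * tailKer t R₀ (q.2 - q.1) + G q.2 ^ 2 * tailKer t R₀ (q.1 - q.2) with hQ
  have hQi : Integrable Q ((volume : Measure ZM).prod volume) := (hQ1.add hQ2).add hQ3
  have hQv : ∫ q, Q q ∂((volume : Measure ZM).prod volume) =
      2 * t * flatJumpBall t (2 * R₀) G + 2 * ((∫ y, G y ^ 2) * ∫ z, tailKer t R₀ z) := by
    have e1 : ∫ q : ZM × ZM, (ballInd (2 * R₀) q.1 * ballInd (2 * R₀) q.2 * (heatKernel t q.1 q.2 * (G q.1 - G q.2) ^ 2) +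
        G q.1 ^ 2 * tailKer t R₀ (q.2 - q.1) + G q.2 ^ 2 * tailKer t R₀ (q.1 - q.2)) ∂((volume : Measure ZM).prod volume) =
        (∫ q : ZM × ZM, (ballInd (2 * R₀) q.1 * ballInd (2 * R₀) q.2 * (heatKernel t q.1 q.2 * (G q.1 - G q.2) ^ 2) +
          G q.1 ^ 2 * tailKer t R₀ (q.2 - q.1)) ∂((volume : Measure ZM).prod volume)) +
        ∫ q : ZM × ZM, G q.2 ^ 2 * tailKer t R₀ (q.1 - q.2) ∂((volume : Measure ZM).prod volume) :=
      integral_add (hQ1.add hQ2) hQ3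
    have e2 : ∫ q : ZM × ZM, (ballInd (2 * R₀) q.1 * ballInd (2 * R₀) q.2 * (heatKernel t q.1 q.2 * (G q.1 - G q.2) ^ 2) +
        G q.1 ^ 2 * tailKer t R₀ (q.2 - q.1)) ∂((volume : Measure ZM).prod volume) =
        (∫ q : ZM × ZM, ballInd (2 * R₀) q.1 * ballInd (2 * R₀) q.2 * (heatKernel t q.1 q.2 * (G q.1 - G q.2) ^ 2)
          ∂((volume : Measure ZM).prod volume)) +
        ∫ q : ZM × ZM, G q.1 ^ 2 * tailKer t R₀ (q.2 - q.1) ∂((volume : Measure ZM).prod volume) :=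
      integral_add hQ1 hQ2
    simp only [hQ]
    rw [e1, e2, vQ2, vQ3, flatJumpBall]
    field_simp
    ring
  -- pointwise majorant
  have hpt : ∀ q : ZM × ZM, heatKernel t q.1 q.2 * (G q.1 - G q.2) ^ 2 ≤ Q q := fun q => by
    rw [hQ]; exact jumpIntegrand_le_three_terms ht hR₀ hsupp q.1 q.2
  -- inner comparison, for a.e. `x`
  have hae : ∀ᵐ x ∂(volume : Measure ZM), (∫ y, heatKernel t x y * (G x - G y) ^ 2) ≤ ∫ y, Q (x, y) := by
    filter_upwards [hQi.prod_right_ae] with x hx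
    exact integral_mono_of_nonneg (ae_of_all _ fun y => mul_nonneg (heatKernel_nonneg ht x y) (sq_nonneg _)) hx
      (ae_of_all _ fun y => hpt (x, y))
  -- outer comparison
  have hout : ∫ x, ∫ y, heatKernel t x y * (G x - G y) ^ 2 ≤ ∫ x, ∫ y, Q (x, y) :=
    integral_mono_of_nonneg (ae_of_all _ fun x => integral_nonneg fun y => mul_nonneg (heatKernel_nonneg ht x y) (sq_nonneg _))
      hQi.integral_prod_left hae
  rw [← integral_prod Q hQi, hQv] at hout
  unfold flatJump
  have ht2 : 0 < 1 / (2 * t) := by positivity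
  calc 1 / (2 * t) * ∫ x, ∫ y, heatKernel t x y * (G x - G y) ^ 2
      ≤ 1 / (2 * t) * (2 * t * flatJumpBall t (2 * R₀) G + 2 * ((∫ y, G y ^ 2) * ∫ z, tailKer t R₀ z)) :=
        mul_le_mul_of_nonneg_left hout ht2.le
    _ = flatJumpBall t (2 * R₀) G + 1 / t * (∫ z, tailKer t R₀ z) * ∫ y, G y ^ 2 := by
        field_simp

/-- **II.4, tail with the explicit Gaussian constant**: `flatJump t G ≤ flatJumpBall t (2R₀) G + t⁻¹ √2⁹ e^{−R₀²/(4t)} ∫ G²`.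
[cite: LiebYau1988, (2.9)–(2.11)] -/
theorem flatJump_le_flatJumpBall_add_exp {t : ℝ} (ht : 0 < t) {G : ZM → ℝ} (hGm : Measurable G) {M : ℝ} (hGb : ∀ y, |G y| ≤ M)
    {R₀ : ℝ} (hR₀ : 0 ≤ R₀) (hsupp : ∀ y, G y ≠ 0 → ‖y‖ ≤ R₀) :
    flatJump t G ≤ flatJumpBall t (2 * R₀) G + 1 / t * (Real.sqrt 2 ^ 9 * Real.exp (-(R₀ ^ 2 / (4 * t)))) * ∫ y, G y ^ 2 := by
  have h := flatJump_le_flatJumpBall_add ht hGm hGb hR₀ hsupp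
  have hT := integral_tailKer_le ht hR₀
  have hG2 : 0 ≤ ∫ y, G y ^ 2 := integral_nonneg fun y => sq_nonneg _
  have h2 : 1 / t * (∫ z, tailKer t R₀ z) * ∫ y, G y ^ 2 ≤ 1 / t * (Real.sqrt 2 ^ 9 * Real.exp (-(R₀ ^ 2 / (4 * t)))) * ∫ y, G y ^ 2 :=
    mul_le_mul_of_nonneg_right (mul_le_mul_of_nonneg_left hT (by positivity)) hG2
  linarith

end Summit.QuantumFields.YangMills.Theorems.FemtoTransferGap

end
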